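import Summits.QuantumFields.YangMills.Theorems.ConvexGribovBodyCovarianceBoundStubConeInequality
import Summits.QuantumFields.YangMills.Theorems.CovarianceBound.Negative.ToronMinimiser
import HarnessLib

/-!
# The cone inequality is asymptotically sharp: the spread toron (crux `CovarianceBound`, stmt-QuantumFields-8780, line `Sketch`)

Route `QuantumFields/YangMills/ConvexGribovBody`, crux
`Summit.QuantumFields.YangMills.Theses.ConvexGribovBody.CovarianceBound`, line `Sketch` (ideator 4: twist-stiffness envelope).

The landed stub `stub_coneInequality` (p138191) bounds the zero mode of the minimal-Coulomb-gauge field by the TWIST GAP: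
`zeroModePair² ≤ 2 (L³ ‖X‖²_F) · twistGap` at every absolute Coulomb minimiser. This file evaluates both sides EXACTLY on the
disprover's spread toron (`Negative.ToronMinimiser`: every direction-`1` link `ω = diag(e^{iπ/L}, e^{-iπ/L})`, `SU(2)` fundamental,
`h = 1` a certified absolute minimiser for `S ≥ 2`):

* `twistMin_toron`   : `twistMin = -6L³` (the untwisting competitor `k(x) = ω^{x₁}` with twist `(ω^L)⁻¹` makes every slice link
  trivial — no better value exists);
* `perMin_toron`     : `perMin = -2L³(cos(π/L) + 2)`;  hence `twistGap_toron : twistGap = 2L³(1 − cos(π/L)) ≈ π² L`;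
* `zeroModePair_toron`: for the generator `X̂ = diag(i, −i)` (`‖X̂‖²_F = 2`, `X̂ ∈ 𝔤`), `zeroModePair = 2L³ sin(π/L) ≈ 2π L²`;
* `coneInequality_sharp_toron`: `zeroModePair² = ((1 + cos(π/L))/2) · [2 (L³‖X̂‖²_F) twistGap]`.

So the ratio of the two sides of the cone inequality is `(1 + cos(π/L))/2 → 1`: the constant `2` is ASYMPTOTICALLY OPTIMAL and no
configuration-wise improvement by any function of `L` tending to infinity is possible — on the fundamental modular region the twist
gap is `≍ L` exactly where the zero mode is `≍ L²`; the factor `L` that `LieModeBoundZero` needs beyond kinematics is entirely the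
measure's (`MeanTwistGapBound`, `…TwistReduction`). This is the twist-gap analogue of `Negative.ToronMinimiser` /
`toron_tight` for the crux's own integrand. Helper lemmas live in the sub-namespace `ToronSharp`; no named facts are used.
-/

set_option autoImplicit false

noncomputable section

namespace Summit.QuantumFields.YangMills.Cruxes.CovarianceBound.TwistStiffness

open scoped BigOperators Matrix ComplexConjugate Real
open NormedSpace
open Literature.MathematicalPhysics.QuantumFieldTheory
open Summit.QuantumFields.YangMills.Cruxes.CovarianceBound.SupportWindow
open Summit.QuantumFields.YangMills.Theorems.CovarianceBound.Negative

namespace ToronSharp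

variable {S : ℕ}

/-! ### Bookkeeping -/

/-- `su2Fund.N = 2`. -/
theorem su2Fund_N : su2Fund.N = 2 := rfl

/-- The slice Coulomb functional of the line's vocabulary is the disprover's `coul` (both transcribe the crux verbatim). -/
theorem coulombF_eq_coul (U : GaugeConfig 4 (2 * S + 1) SU2) (h : Site 4 (2 * S + 1) → SU2) :
    coulombF su2Fund S U h = coul su2Fund S U h := rfl

/-- The time-zero slice has `3 (2S+1)³` spatial links: `Σ_{e slice} c = 3 L³ c`. -/
theorem sum_slice_const (c : ℝ) :
    (∑ e : Edge 4 (2 * S + 1), if e.1 0 = 0 ∧ e.2 ≠ 0 then c else 0) = 3 * (2 * S + 1 : ℝ) ^ 3 * c := by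
  rw [CoulombFP.sum_edge_slice_eq, Finset.sum_const, Finset.card_univ, nsmul_eq_mul, Fintype.card_prod,
    Fintype.card_fin, Nat.cast_mul, SupMeasurable.card_slice]
  push_cast
  ring

/-- `h = 1` is an absolute Coulomb minimiser of the spread toron (`coul_toron_one_le`). -/
theorem isCoulMin_toron_one (hS : 2 ≤ S) : IsCoulMin su2Fund S (toron S) 1 :=
  fun h => coul_toron_one_le hS h

/-! ### The twisted minimum of the toron: untwisting makes every link trivial -/

/-- The untwisting gauge transformation `k(x) = ω^{x₁}`. -/
def kω (S : ℕ) : Site 4 (2 * S + 1) → SU2 := fun x => omegaL S ^ (x 1).val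

/-- Along direction `1`, away from the seam: `ω^n ω (ω^{n+1})⁻¹ = 1`. -/
theorem gaugeTransform_kω_one_of_ne (x : Site 4 (2 * S + 1)) (hn : (x 1).val ≠ 2 * S) :
    gaugeTransform (kω S) (toron S) (x, 1) = 1 := by
  have hlt : (x 1).val < 2 * S + 1 := (x 1).val_lt
  obtain _ | S := S
  · exfalso; omega
  · have h1 : (1 : ZMod (2 * (S + 1) + 1)).val = 1 := by
      rw [ZMod.val_one_eq_one_mod]; exact Nat.mod_eq_of_lt (by omega)
    have hval : ((x 1 + 1 : ZMod (2 * (S + 1) + 1))).val = (x 1).val + 1 := by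
      rw [ZMod.val_add, h1, Nat.mod_eq_of_lt (by omega)]
    simp only [gaugeTransform, kω, toron, if_true, ConeInequality.shift_apply_self, hval, pow_succ]
    group

/-- On the seam link of direction `1`: `ω^{2S} ω (ω^0)⁻¹ · (ω^L)⁻¹ = 1`. -/
theorem gaugeTransform_kω_one_of_eq (x : Site 4 (2 * S + 1)) (hn : (x 1).val = 2 * S) :
    gaugeTransform (kω S) (toron S) (x, 1) * (omegaL S ^ (2 * S + 1))⁻¹ = 1 := by
  have hval : ((x 1 + 1 : ZMod (2 * S + 1))).val = 0 := ConeInequality.val_add_one_of_eq S (x 1) hn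
  simp only [gaugeTransform, kω, toron, if_true, ConeInequality.shift_apply_self, hval, hn, pow_zero, inv_one,
    mul_one, ← pow_succ, mul_inv_cancel]

/-- In the transverse directions the toron link is `1` and `k` conjugates it to `1`. -/
theorem gaugeTransform_kω_of_ne_one (x : Site 4 (2 * S + 1)) {i : Fin 4} (hi : i ≠ 1) :
    gaugeTransform (kω S) (toron S) (x, i) = 1 := by
  simp only [gaugeTransform, kω, toron, if_neg hi, mul_one, ConeInequality.shift_apply_of_ne x (Ne.symm hi),
    mul_inv_cancel]

/-- The untwisted toron: every slice link of `(toron)^{kω}` twisted by `(ω^L)⁻¹` is trivial, so the twisted functional takes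
the absolute minimum `-6L³`. -/
theorem twistedCoulombF_toron_untwist :
    twistedCoulombF su2Fund S 0 (toron S) (kω S) (omegaL S ^ (2 * S + 1))⁻¹ = -(6 * (2 * S + 1 : ℝ) ^ 3) := by
  have hone : (su2Fund.ρ 1).trace.re = 2 := by rw [su2Fund_trace_re]; exact re_trace_one_su2
  have h2 : ∀ e : Edge 4 (2 * S + 1), e.1 0 = 0 ∧ e.2 ≠ 0 →
      (su2Fund.ρ (gaugeTransform (kω S) (toron S) e *
        (if e.2 = (0 : Fin 3).succ ∧ (e.1 (0 : Fin 3).succ).val = 2 * S then (omegaL S ^ (2 * S + 1))⁻¹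
          else 1))).trace.re = 2 := by
    rintro ⟨x, i⟩ _
    simp only [Fin.succ_zero_eq_one]
    by_cases hi : i = 1
    · subst hi
      by_cases hn : (x 1).val = 2 * S
      · rw [if_pos ⟨rfl, hn⟩, gaugeTransform_kω_one_of_eq x hn, hone]
      · rw [if_neg (fun h' => hn h'.2), mul_one, gaugeTransform_kω_one_of_ne x hn, hone]
    · rw [if_neg (fun h' => hi h'.1), mul_one, gaugeTransform_kω_of_ne_one x hi, hone]
  unfold twistedCoulombF
  rw [neg_inj]
  refine Eq.trans (Finset.sum_congr rfl
    (g := fun e : Edge 4 (2 * S + 1) => if e.1 0 = 0 ∧ e.2 ≠ 0 then (2 : ℝ) else 0) fun e _ => ?_) ?_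
  · by_cases he : e.1 0 = 0 ∧ e.2 ≠ 0
    · rw [if_pos he, if_pos he]
      exact h2 e he
    · rw [if_neg he, if_neg he]
  · rw [sum_slice_const]
    ring

/-- **`twistMin(toron) = -6L³`**: the untwisting competitor attains the absolute lower bound of the twisted functional. -/
theorem twistMin_toron : twistMin su2Fund S 0 (toron S) = -(6 * (2 * S + 1 : ℝ) ^ 3) := by
  refine le_antisymm ?_ (le_ciInf fun th => ?_)
  · rw [← twistedCoulombF_toron_untwist (S := S)]
    exact ciInf_le (TwistGapMeasurable.bddBelow_range_twistedCoulombF su2Fund S 0 (toron S))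
      ((omegaL S ^ (2 * S + 1))⁻¹, kω S)
  · have h := TwistGapMeasurable.neg_le_twistedCoulombF su2Fund S 0 (toron S) th.2 th.1
    rw [su2Fund_N] at h
    norm_num at h ⊢
    linarith

/-! ### The periodic minimum of the toron -/

/-- The value of the slice Coulomb functional of the toron in the gauge `h = 1`: `-L³(2cos(π/L) + 4)`. -/
theorem coulombF_toron_one : coulombF su2Fund S (toron S) 1 = -((2 * S + 1 : ℝ) ^ 3 * (2 * Real.cos (thetaL S) + 4)) := by
  rw [SupportLie.coulombF_eq, gaugeTransform_one']
  congr 1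
  rw [Fintype.sum_prod_type]
  have hy : ∀ y : Fin 3 → ZMod (2 * S + 1),
      ∑ j' : Fin 3, (su2Fund.ρ (toron S (Fin.cons 0 y, j'.succ))).trace.re = 2 * Real.cos (thetaL S) + 4 := by
    intro y
    rw [Fin.sum_univ_three]
    simp only [toron, Fin.succ_zero_eq_one, if_true, Fin.succ_one_eq_two,
      show (2 : Fin 4) ≠ 1 by decide, if_false, show (2 : Fin 3).succ = (3 : Fin 4) by decide,
      show (3 : Fin 4) ≠ 1 by decide, su2Fund_trace_re, re_trace_omegaL, re_trace_one_su2]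
    ring
  rw [Finset.sum_congr rfl fun y _ => hy y, Finset.sum_const, Finset.card_univ, nsmul_eq_mul,
    SupMeasurable.card_slice]

/-- **`perMin(toron) = -L³(2cos(π/L) + 4)`** for `S ≥ 2` (`h = 1` is an absolute minimiser). -/
theorem perMin_toron (hS : 2 ≤ S) :
    perMin su2Fund S (toron S) = -((2 * S + 1 : ℝ) ^ 3 * (2 * Real.cos (thetaL S) + 4)) := by
  rw [ConeInequality.perMin_eq_of_isCoulMin su2Fund S (toron S) 1 (isCoulMin_toron_one hS), coulombF_toron_one]

/-- **`twistGap(toron) = 2L³(1 − cos(π/L))`** (`≈ π² L`): the twist gap of the spread toron grows linearly in `L`. -/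
theorem twistGap_toron (hS : 2 ≤ S) :
    twistGap su2Fund S 0 (toron S) = 2 * (2 * S + 1 : ℝ) ^ 3 * (1 - Real.cos (thetaL S)) := by
  unfold twistGap
  rw [perMin_toron hS, twistMin_toron]
  ring

/-! ### The zero mode of the toron along the Cartan generator -/

/-- The Cartan generator `X̂ = diag(i, −i)` of `SU(2)` (`exp(t X̂) = diag(e^{it}, e^{-it})`). -/
def Xhat : Matrix (Fin 2) (Fin 2) ℂ := Matrix.diagonal ![Complex.I, -Complex.I]

/-- `‖X̂‖²_F = 2`. -/
theorem froSq_Xhat : froSq Xhat = 2 := by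
  unfold froSq Xhat
  simp [Fin.sum_univ_two, Matrix.diagonal_apply]
  norm_num

/-- `X̂` is skew-Hermitian. -/
theorem star_Xhat : star Xhat = -Xhat := by
  unfold Xhat
  rw [Matrix.star_eq_conjTranspose, Matrix.diagonal_conjTranspose, Matrix.diagonal_neg]
  congr 1
  funext i
  fin_cases i <;> simp

/-- `exp(t X̂) = diag(e^{it}, e^{-it})` lies in (the fundamental representation of) `SU(2)`. -/
theorem exp_smul_Xhat_mem (t : ℝ) : exp (t • Xhat) ∈ Set.range su2Fund.ρ := by
  have hexp : exp (t • Xhat) = Matrix.diagonal ![Complex.exp (t * Complex.I), Complex.exp (-(t * Complex.I))] := by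
    unfold Xhat
    rw [← Matrix.diagonal_smul, Matrix.exp_diagonal]
    congr 1
    funext i
    fin_cases i
    · simp [Complex.exp_eq_exp_ℂ, Complex.real_smul]
    · simp [Complex.exp_eq_exp_ℂ, Complex.real_smul]
  have hmem : Matrix.diagonal ![Complex.exp (t * Complex.I), Complex.exp (-(t * Complex.I))] ∈
      Matrix.specialUnitaryGroup (Fin 2) ℂ := by
    rw [Matrix.mem_specialUnitaryGroup_iff, Matrix.mem_unitaryGroup_iff]
    refine ⟨?_, ?_⟩
    · rw [Matrix.star_eq_conjTranspose, Matrix.diagonal_conjTranspose, Matrix.diagonal_mul_diagonal,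
        ← Matrix.diagonal_one]
      congr 1
      funext i
      have key : ∀ z : ℂ, z.re = 0 → Complex.exp z * star (Complex.exp z) = 1 := by
        intro z hz
        rw [Complex.star_def, ← Complex.exp_conj, ← Complex.exp_add, Complex.add_conj, hz]
        simp
      fin_cases i
      · exact key _ (by simp)
      · exact key _ (by simp)
    · rw [Matrix.det_diagonal, Fin.prod_univ_two]
      simp only [Matrix.cons_val_zero, Matrix.cons_val_one, Matrix.cons_val_fin_one]
      rw [← Complex.exp_add, add_neg_cancel, Complex.exp_zero]
  exact ⟨⟨_, hmem⟩, hexp.symm⟩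

/-- `X̂ ∈ 𝔤` (the defining set `lieAlgCarrier` of the fundamental `SU(2)` representation). -/
theorem Xhat_mem_lieAlgCarrier : Xhat ∈ su2Fund.lieAlgCarrier := ⟨star_Xhat, exp_smul_Xhat_mem⟩

/-- `Re tr(ω X̂) = -2 sin(π/L)`. -/
theorem re_trace_omegaL_mul_Xhat :
    ((omegaL S : Matrix (Fin 2) (Fin 2) ℂ) * Xhat).trace.re = -2 * Real.sin (thetaL S) := by
  rw [omegaL_val, Xhat, Matrix.diagonal_mul_diagonal, Matrix.trace_diagonal, Fin.sum_univ_two]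
  simp only [omegaVec, Matrix.cons_val_zero, Matrix.cons_val_one, Matrix.cons_val_fin_one]
  have h1 : Complex.exp ((thetaL S : ℂ) * Complex.I) * Complex.I +
      Complex.exp (-((thetaL S : ℂ) * Complex.I)) * -Complex.I = -2 * Complex.sin (thetaL S) := by
    rw [Complex.sin]
    ring
  rw [h1, Complex.mul_re, Complex.sin_ofReal_re, Complex.sin_ofReal_im]
  norm_num

/-- **The zero mode of the toron along `X̂`**: `zeroModePair = 2L³ sin(π/L)` in the gauge `h = 1`. -/
theorem zeroModePair_toron :
    zeroModePair su2Fund S 0 (toron S) 1 Xhat = 2 * (2 * S + 1 : ℝ) ^ 3 * Real.sin (thetaL S) := by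
  have hskew : Xhatᴴ = -Xhat := by rw [← Matrix.star_eq_conjTranspose]; exact star_Xhat
  have h := ConeInequality.sum_re_trace_mul_eq_neg_zeroModePair su2Fund S 0 (toron S) 1 hskew
  rw [gaugeTransform_one'] at h
  simp only [toron, Fin.succ_zero_eq_one, if_true] at h
  rw [Finset.sum_const, Finset.card_univ, nsmul_eq_mul, SupMeasurable.card_slice] at h
  have h' : (2 * S + 1 : ℝ) ^ 3 * (((omegaL S : Matrix (Fin 2) (Fin 2) ℂ)) * Xhat).trace.re =
      -zeroModePair su2Fund S 0 (toron S) 1 Xhat := h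
  rw [re_trace_omegaL_mul_Xhat] at h'
  linarith

end ToronSharp

open ToronSharp

/-- **The cone inequality is asymptotically sharp on the spread toron** (registered glue of the line `Sketch`): for `S ≥ 2`,
with `h = 1` an absolute Coulomb minimiser of `toron S` and the Cartan generator `X̂ ∈ 𝔤`,
`zeroModePair² = ((1 + cos(π/L))/2) · (2 (L³ ‖X̂‖²_F) · twistGap)` — the ratio of the two sides of `stub_coneInequality` tends to
`1`; no configuration-wise improvement of the cone inequality by a divergent function of `L` exists. -/
theorem coneInequality_sharp_toron {S : ℕ} (hS : 2 ≤ S) :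
    zeroModePair su2Fund S 0 (toron S) 1 Xhat ^ 2 =
      (1 + Real.cos (thetaL S)) / 2 *
        (2 * ((2 * S + 1 : ℝ) ^ 3 * froSq Xhat) * twistGap su2Fund S 0 (toron S)) := by
  rw [zeroModePair_toron, twistGap_toron hS, froSq_Xhat]
  linear_combination 4 * (2 * S + 1 : ℝ) ^ 6 * Real.sin_sq_add_cos_sq (thetaL S)

/-- The hypotheses of `stub_coneInequality` are met on the toron: `h = 1` is an absolute minimiser and `X̂ ∈ 𝔤`; the stub's
conclusion there is the inequality `((1 + cos(π/L))/2) · R ≤ R`. -/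
theorem coneInequality_toron_instance {S : ℕ} (hS : 2 ≤ S) :
    zeroModePair su2Fund S 0 (toron S) 1 Xhat ^ 2 ≤
      2 * ((2 * S + 1 : ℝ) ^ 3 * froSq Xhat) * twistGap su2Fund S 0 (toron S) :=
  stub_coneInequality su2Fund S 0 Xhat Xhat_mem_lieAlgCarrier (toron S) 1 (isCoulMin_toron_one hS)

end Summit.QuantumFields.YangMills.Cruxes.CovarianceBound.TwistStiffness

end
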